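import Literature.Probability.LatticeModels.SixVertexTwoPointGeneral
import Literature.Probability.LatticeModels.SixVertexSpectralIntegrands
import Mathlib.MeasureTheory.Integral.Bochner.Basic
import Mathlib.Analysis.SpecialFunctions.Complex.Arg

/-!
# Six-vertex model: Theorem 23 — the spectral measure `μ_L` and the integral form
# (DKLM 2026, Theorem 23 and its proof, Step 3)

H. Duminil-Copin, K. K. Kozlowski, P. Lammers, I. Manolescu, *Gaussian free field convergence of
the six-vertex model with `-1 ≤ Δ ≤ -1/2`*, arXiv:2603.06268 (2026) [DKLM2026SixVertexGFF]
(`paper:arxiv-2603.06268`, chunks p0019, p0022, p0044):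

> **Theorem 23** (Spectral representation of the two-point function). Fix `c > 0` and
> `L ∈ 2ℤ_{>0}`. Then, there exists a finite positive measure `μ_L` on `ℝ_{>0} × ℝ` such that
> `Φ_{CYL_L,2}(u) = ∫ ((1-a)^{x₂}e^{-iby₂} - 1)(1-a)^{x₁'}e^{-iby₁'}(1 - (1-a)^{x₁}e^{-iby₁}) dμ_L(a,b)`
> for any horizontally ordered `u = (u₁,u₁',u₂,u₂') ⊂ ℤ²`, and which is supported on the set
> `(0,2] × [-π,π]` and invariant under the map `(a,b) ↦ (a,-b)`. Furthermore,
> `μ_L({|b| ∈ (0,2π/L)}) = 0`.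
>
> (§1.2) `χ^discr_u(a,b) := ((1-a)^{x₂}e^{-iby₂} - 1)(1-a)^{x₁'}e^{-iby₁'}(1 - (1-a)^{x₁}e^{-iby₁})`.
>
> (Proof, Step 3: Conclusion) We constructed the measure `μ_L` above, we observed that it is
> supported on `(0,2) × [-π,π)` […]. The fact that `μ_L[{|b| ∈ (0,2π/L)}] = 0` follows from the
> observation that the eigenvalues `e^{-ib}` of `T(0)` are `L`-th roots of unity. Finally, […]
> `μ_L` is invariant under the reflection `(a,b) ↦ (a,-b)` […] as we may simply replace `μ_L` by
> its symmetrised version `(μ_L + μ̄_L)/2` owing to the real-valuedness of the correlation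
> function.

For `c > 0` and `L = 2(ℓ+1)`, with the atoms `a_k = dklmAtomA`, phases `ω_k = transferJointPhase`
(`|ω_k| = 1`, `ω_k^L = 1`) and weights `w_k = dklmWeight ≥ 0` of `SixVertexTwoPointMeasure.lean`:

* the integrand `χ^discr_u` is `chiDiscr` of `SixVertexSpectralIntegrands.lean` (`conj χ(a,b) = χ(a,-b)`);
* `dklmPhaseB k = arg ω_k ∈ (-π, π]`, `e^{i b_k} = ω_k`, `b_k L ∈ 2πℤ`;
* **`dklmMeasure c hc ℓ = μ_L := ∑_k (w_k/2) (δ_{(a_k,b_k)} + δ_{(a_k,-b_k)})`**, a finite (positive)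
  measure on `ℝ × ℝ` (the symmetrised version of Step 3), with `integral_dklmMeasure`,
  **`dklmMeasure_map_reflect`** (invariance under `(a,b) ↦ (a,-b)`), **`dklmMeasure_compl_support`**
  (`μ_L` is carried by `(0,2) × [-π,π]`), **`dklmMeasure_smallPhase`** (`μ_L{|b| ∈ (0,2π/L)} = 0`);
* `ofReal_eq_integral_dklmMeasure` — Step 3: a real number equal to `∑_k w_k f(a_k,b_k)` with
  `conj f(a,b) = f(a,-b)` equals `∫ f dμ_L`;
* **`cylinderPairExp_lPairObs_lPairObs_eq_integral` — Theorem 23, eq. (eq:thm23):**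
  `Φ_{CYL_L,2}(u) = ∫ χ^discr_u dμ_L` for both pairs L-shaped (`x₁, x₂ ≥ 1`, `x₁' ≥ 0`, vertical
  displacements `y₁ = q₁, y₂ = q₂ ≥ 0`, `y₁' = y(u₂) - y(u₁')`), and the corner cases `x₁ = 0` /
  `x₂ = 0` (purely vertical pairs, `cylinderPairExp_colObs_lPairObs_eq_integral`,
  `cylinderPairExp_lPairObs_colObs_eq_integral`, `cylinderPairExp_colObs_colObs_eq_integral`)
  obtained from it by bilinearity (a vertical difference is a difference of two L-observables);
* **`exists_dklm_spectralMeasure` — Theorem 23 as printed** (existence of a finite positive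
  measure with the four listed properties), witnessed by `dklmMeasure`.

Pairs are encoded as strip observables (`SixVertexTwoPointMeasure.lean`,
`SixVertexTwoPointVertical.lean`): pair `i` lives in strip `i` (strip 2 at horizontal offset
`r₁'+1+k`), rows are taken in `ℤ/Lℤ` (the cylinder) with north displacements `q_i ≥ 0`, and a
purely vertical pair sits at a face `s+1`, `s < r'+1`, of its strip.

## References

* H. Duminil-Copin, K. K. Kozlowski, P. Lammers, I. Manolescu, arXiv:2603.06268 (2026), Theorem 23
  and its proof (Step 3), §1.2 of Part II (`χ^discr`). [DKLM2026SixVertexGFF]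
-/

noncomputable section

open Finset Matrix Filter Topology MeasureTheory
open Literature.LinearAlgebra.Matrix

namespace Literature.Probability.LatticeModels.SixVertex

/-! ## 1. The integrand `χ^discr_u` is `chiDiscr` (`SixVertexSpectralIntegrands.lean`) -/

/-! ## 2. The phases `b_k = arg ω_k` -/

section Phase

variable (c : ℝ) (ℓ : ℕ)

/-- **The second coordinate `b_k ∈ (-π, π]` of the atoms of `μ_L`**: `ω_k = e^{i b_k}` for the
eigenvalue `ω_k` of `T(0)` (`Λ_k(0) = e^{-ib}` in the paper's transposed convention).
[cite: DKLM2026SixVertexGFF, proof of Theorem 23 (def. of `μ_L`)] -/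
def dklmPhaseB (k : {κ : ZMod (2 * (ℓ + 1)) → Bool // IsBalancedCol κ}) : ℝ :=
  Complex.arg (transferJointPhase c ℓ k)

/-- `b_k ∈ (-π, π]`. [cite: DKLM2026SixVertexGFF, Theorem 23] -/
theorem dklmPhaseB_mem_Ioc (k : {κ : ZMod (2 * (ℓ + 1)) → Bool // IsBalancedCol κ}) :
    dklmPhaseB c ℓ k ∈ Set.Ioc (-Real.pi) Real.pi :=
  Complex.arg_mem_Ioc _

/-- `e^{i b_k} = ω_k` (`|ω_k| = 1`). [cite: DKLM2026SixVertexGFF, Lemma 60] -/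
theorem exp_dklmPhaseB_mul_I (k : {κ : ZMod (2 * (ℓ + 1)) → Bool // IsBalancedCol κ}) :
    Complex.exp ((dklmPhaseB c ℓ k : ℂ) * Complex.I) = transferJointPhase c ℓ k := by
  have h := Complex.norm_mul_exp_arg_mul_I (transferJointPhase c ℓ k)
  rwa [norm_transferJointPhase, Complex.ofReal_one, one_mul] at h

/-- `ω_k^n = e^{i n b_k}`. [cite: DKLM2026SixVertexGFF, Lemma 60] -/
theorem exp_I_mul_dklmPhaseB_mul (k : {κ : ZMod (2 * (ℓ + 1)) → Bool // IsBalancedCol κ}) (n : ℕ) :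
    Complex.exp (Complex.I * (dklmPhaseB c ℓ k : ℂ) * n) = transferJointPhase c ℓ k ^ n := by
  rw [← exp_dklmPhaseB_mul_I, ← Complex.exp_nat_mul]
  congr 1
  ring

/-- `ω̄_k^n = e^{-i n b_k}`. [cite: DKLM2026SixVertexGFF, Lemma 60] -/
theorem exp_neg_I_mul_dklmPhaseB_mul (k : {κ : ZMod (2 * (ℓ + 1)) → Bool // IsBalancedCol κ}) (n : ℕ) :
    Complex.exp (-(Complex.I * (dklmPhaseB c ℓ k : ℂ) * n)) = star (transferJointPhase c ℓ k) ^ n := by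
  have h1 : star (transferJointPhase c ℓ k) = Complex.exp (-((dklmPhaseB c ℓ k : ℂ) * Complex.I)) := by
    rw [← exp_dklmPhaseB_mul_I, RCLike.star_def, ← Complex.exp_conj, map_mul, Complex.conj_ofReal,
      Complex.conj_I, mul_neg]
  rw [h1, ← Complex.exp_nat_mul]
  congr 1
  ring

/-- **`b_k L ∈ 2πℤ`**: the eigenvalues of `T(0)` are `L`-th roots of unity.
[cite: DKLM2026SixVertexGFF, proof of Theorem 23, Step 3] -/
theorem exists_dklmPhaseB_mul_eq (k : {κ : ZMod (2 * (ℓ + 1)) → Bool // IsBalancedCol κ}) :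
    ∃ n : ℤ, dklmPhaseB c ℓ k * (2 * (ℓ + 1)) = n * (2 * Real.pi) := by
  have h := transferJointPhase_pow_card c ℓ k
  rw [← exp_I_mul_dklmPhaseB_mul, Complex.exp_eq_one_iff] at h
  obtain ⟨n, hn⟩ := h
  refine ⟨n, ?_⟩
  have him := congrArg Complex.im hn
  simp only [Complex.mul_im, Complex.I_re, Complex.I_im, Complex.ofReal_re, Complex.ofReal_im,
    Complex.natCast_re, Complex.natCast_im, Complex.intCast_re, Complex.intCast_im, Complex.mul_re,
    Complex.re_ofNat, Complex.im_ofNat, mul_zero, zero_mul, sub_zero, add_zero, zero_add, mul_one,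
    one_mul] at him
  push_cast at him ⊢
  linarith

/-- **`μ_L({|b| ∈ (0, 2π/L)}) = 0`, atom by atom**: `|b_k| ∉ (0, 2π/L)`.
[cite: DKLM2026SixVertexGFF, Theorem 23 and its proof, Step 3] -/
theorem abs_dklmPhaseB_not_mem_Ioo (k : {κ : ZMod (2 * (ℓ + 1)) → Bool // IsBalancedCol κ}) :
    |dklmPhaseB c ℓ k| ∉ Set.Ioo 0 (2 * Real.pi / (2 * (ℓ + 1))) := by
  obtain ⟨n, hn⟩ := exists_dklmPhaseB_mul_eq c ℓ k
  rintro ⟨h0, h1⟩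
  have hL : (0 : ℝ) < 2 * (ℓ + 1) := by positivity
  have hb : |dklmPhaseB c ℓ k| * (2 * (ℓ + 1)) = |(n : ℝ)| * (2 * Real.pi) := by
    rw [← abs_of_pos hL, ← abs_mul, hn, abs_mul, abs_of_pos (by positivity : (0 : ℝ) < 2 * Real.pi)]
  have hn0 : n ≠ 0 := by
    rintro rfl
    rw [Int.cast_zero, abs_zero, zero_mul, mul_eq_zero] at hb
    rcases hb with hb | hb
    · exact h0.ne' hb
    · exact hL.ne' hb
  have h1' : (1 : ℝ) ≤ |(n : ℝ)| := by exact_mod_cast Int.one_le_abs hn0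
  rw [lt_div_iff₀ hL] at h1
  nlinarith [Real.pi_pos]

/-- `|-b_k| ∉ (0, 2π/L)` as well. [cite: DKLM2026SixVertexGFF, Theorem 23] -/
theorem abs_neg_dklmPhaseB_not_mem_Ioo (k : {κ : ZMod (2 * (ℓ + 1)) → Bool // IsBalancedCol κ}) :
    |-dklmPhaseB c ℓ k| ∉ Set.Ioo 0 (2 * Real.pi / (2 * (ℓ + 1))) := by
  rw [abs_neg]; exact abs_dklmPhaseB_not_mem_Ioo c ℓ k

end Phase

/-! ## 3. The spectral measure `μ_L` -/

section Measure

variable (c : ℝ) (hc : 0 < c) (ℓ : ℕ)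

/-- `w_{k₀} = 0`. [cite: DKLM2026SixVertexGFF, proof of Theorem 23, Step 1 (the `k = 0` term is omitted)] -/
theorem dklmWeight_topIdx : dklmWeight c hc ℓ (topIdx c hc ℓ) = 0 := by
  unfold dklmWeight
  rw [if_pos rfl]

/-- **The spectral measure `μ_L := ∑_k (w_k/2)(δ_{(a_k,b_k)} + δ_{(a_k,-b_k)})`** on `ℝ × ℝ` — the
symmetrised finite sum of Dirac masses of the proof of Theorem 23 (Step 3).
[cite: DKLM2026SixVertexGFF, Theorem 23 and its proof, Steps 1 and 3] -/
def dklmMeasure : Measure (ℝ × ℝ) :=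
  ∑ k, (dklmWeight c hc ℓ k / 2).toNNReal •
    (Measure.dirac (dklmAtomA c ℓ k, dklmPhaseB c ℓ k) +
      Measure.dirac (dklmAtomA c ℓ k, -dklmPhaseB c ℓ k))

/-- **`μ_L` is a finite (positive) measure.** [cite: DKLM2026SixVertexGFF, Theorem 23] -/
instance isFiniteMeasure_dklmMeasure : IsFiniteMeasure (dklmMeasure c hc ℓ) := by
  unfold dklmMeasure; infer_instance

/-- **Integration against `μ_L`** is the weighted finite sum over the atoms.
[cite: DKLM2026SixVertexGFF, proof of Theorem 23 ("`μ_L` is a finite sum of Dirac measures")] -/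
theorem integral_dklmMeasure (f : ℝ × ℝ → ℂ) :
    ∫ p, f p ∂dklmMeasure c hc ℓ =
      ∑ k, ((dklmWeight c hc ℓ k / 2 : ℝ) : ℂ) *
        (f (dklmAtomA c ℓ k, dklmPhaseB c ℓ k) + f (dklmAtomA c ℓ k, -dklmPhaseB c ℓ k)) := by
  have hint : ∀ p : ℝ × ℝ, Integrable f (Measure.dirac p) := fun p => integrable_dirac enorm_lt_top
  unfold dklmMeasure
  rw [integral_finsetSum_measure fun k _ => ((hint _).add_measure (hint _)).smul_measure_nnreal]
  refine Finset.sum_congr rfl fun k _ => ?_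
  rw [integral_smul_nnreal_measure, integral_add_measure (hint _) (hint _), integral_dirac, integral_dirac,
    NNReal.smul_def, Real.coe_toNNReal _ (by linarith [dklmWeight_nonneg c hc ℓ k]), Complex.real_smul]

/-- The mass of a set. [cite: DKLM2026SixVertexGFF, Theorem 23] -/
theorem dklmMeasure_apply (s : Set (ℝ × ℝ)) :
    dklmMeasure c hc ℓ s =
      ∑ k, ((dklmWeight c hc ℓ k / 2).toNNReal : ENNReal) *
        (s.indicator 1 (dklmAtomA c ℓ k, dklmPhaseB c ℓ k) + s.indicator 1 (dklmAtomA c ℓ k, -dklmPhaseB c ℓ k)) := by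
  unfold dklmMeasure
  rw [Measure.finsetSum_apply]
  simp only [Measure.coe_nnreal_smul_apply, Measure.add_apply, Measure.dirac_apply]

/-- A finite sum of measures is pushed forward term by term. [folklore] -/
theorem measure_map_finsetSum {α β ι : Type*} [MeasurableSpace α] [MeasurableSpace β] (s : Finset ι)
    (μ : ι → Measure α) {f : α → β} (hf : Measurable f) :
    (∑ i ∈ s, μ i).map f = ∑ i ∈ s, (μ i).map f := by
  classical
  induction s using Finset.induction_on with
  | empty => simp
  | insert a s ha ih => rw [Finset.sum_insert ha, Finset.sum_insert ha, Measure.map_add _ _ hf, ih]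

/-- **`μ_L` is invariant under the reflection `(a,b) ↦ (a,-b)`.**
[cite: DKLM2026SixVertexGFF, Theorem 23 and its proof, Step 3] -/
theorem dklmMeasure_map_reflect :
    (dklmMeasure c hc ℓ).map (fun p : ℝ × ℝ => (p.1, -p.2)) = dklmMeasure c hc ℓ := by
  have hσ : Measurable (fun p : ℝ × ℝ => (p.1, -p.2)) := measurable_fst.prodMk measurable_snd.neg
  unfold dklmMeasure
  rw [measure_map_finsetSum _ _ hσ]
  refine Finset.sum_congr rfl fun k _ => ?_
  rw [Measure.map_smul, Measure.map_add _ _ hσ, Measure.map_dirac, Measure.map_dirac, neg_neg, add_comm]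

include hc in
/-- **`μ_L` is supported on `(0,2) × [-π,π]`** (`⊆ (0,2] × [-π,π]` as printed in Theorem 23; the
proof observes `(0,2) × [-π,π)` before symmetrisation). [cite: DKLM2026SixVertexGFF, Theorem 23 and its proof, Step 3] -/
theorem dklmMeasure_compl_support :
    dklmMeasure c hc ℓ (Set.Ioo (0 : ℝ) 2 ×ˢ Set.Icc (-Real.pi) Real.pi)ᶜ = 0 := by
  rw [dklmMeasure_apply]
  refine Finset.sum_eq_zero fun k _ => ?_
  by_cases hk : k = topIdx c hc ℓ
  · rw [hk, dklmWeight_topIdx, zero_div, Real.toNNReal_zero, ENNReal.coe_zero, zero_mul]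
  · have ha := dklmAtomA_mem_Ioo c hc ℓ hk
    have hb := dklmPhaseB_mem_Ioc c ℓ k
    rw [Set.indicator_of_notMem, Set.indicator_of_notMem, add_zero, mul_zero]
    · rw [Set.notMem_compl_iff]
      exact ⟨ha, by linarith [hb.1, hb.2], by linarith [hb.1, hb.2]⟩
    · rw [Set.notMem_compl_iff]
      exact ⟨ha, hb.1.le, hb.2⟩

/-- **`μ_L({|b| ∈ (0, 2π/L)}) = 0`** (`L = 2(ℓ+1)`).
[cite: DKLM2026SixVertexGFF, Theorem 23 and its proof, Step 3] -/
theorem dklmMeasure_smallPhase :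
    dklmMeasure c hc ℓ {p : ℝ × ℝ | |p.2| ∈ Set.Ioo 0 (2 * Real.pi / (2 * (ℓ + 1)))} = 0 := by
  rw [dklmMeasure_apply]
  refine Finset.sum_eq_zero fun k _ => ?_
  rw [Set.indicator_of_notMem, Set.indicator_of_notMem, add_zero, mul_zero]
  · exact abs_neg_dklmPhaseB_not_mem_Ioo c ℓ k
  · exact abs_dklmPhaseB_not_mem_Ioo c ℓ k

/-! ### Step 3: symmetrisation — real sums over the atoms are integrals against `μ_L` -/

/-- **Step 3 (symmetrisation).** If a real number `Φ` equals `∑_k w_k f(a_k, b_k)` and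
`conj f(a,b) = f(a,-b)`, then `Φ = ∫ f dμ_L` ("we may simply replace `μ_L` by its symmetrised
version `(μ_L + μ̄_L)/2` owing to the real-valuedness of the correlation function").
[cite: DKLM2026SixVertexGFF, proof of Theorem 23, Step 3] -/
theorem ofReal_eq_integral_dklmMeasure {Φ : ℝ} {f : ℝ × ℝ → ℂ}
    (hf : ∀ a b : ℝ, starRingEnd ℂ (f (a, b)) = f (a, -b))
    (h : (Φ : ℂ) = ∑ k, (dklmWeight c hc ℓ k : ℂ) * f (dklmAtomA c ℓ k, dklmPhaseB c ℓ k)) :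
    (Φ : ℂ) = ∫ p, f p ∂dklmMeasure c hc ℓ := by
  have hre : Φ = ∑ k, dklmWeight c hc ℓ k * (f (dklmAtomA c ℓ k, dklmPhaseB c ℓ k)).re := by
    have := congrArg Complex.re h
    simpa only [Complex.ofReal_re, Complex.re_sum, Complex.re_ofReal_mul] using this
  rw [integral_dklmMeasure, hre, Complex.ofReal_sum]
  refine Finset.sum_congr rfl fun k _ => ?_
  rw [← hf, Complex.ofReal_mul, Complex.re_eq_add_conj]
  push_cast
  ring

end Measure

/-! ## 4. Theorem 23: `Φ_{CYL_L,2}(u) = ∫ χ^discr_u dμ_L` -/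

section Theorem23

variable (c : ℝ) (hc : 0 < c) (ℓ : ℕ)

/-- **`ω = e^{ib}` turns the spectral sum into `χ^discr`**: for `x₁, x₂ ≥ 0`,
`((1-a)^{x₂} ω̄^{y₂+q₂} - ω̄^{y₂})(1-a)^{x₁'}(ω^{y₀+q₁} - (1-a)^{x₁} ω^{y₀}) = χ^discr(a_k, b_k)` with
`y₁ = q₁`, `y₁' = y₂ - y₀ - q₁`, `y₂ ↦ q₂` (`|ω| = 1`).
[cite: DKLM2026SixVertexGFF, proof of Theorem 23, Steps 1–2] -/
theorem spectralTerm_eq_chiDiscr (k : {κ : ZMod (2 * (ℓ + 1)) → Bool // IsBalancedCol κ})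
    (x₁ q₁ x₁' x₂ q₂ y₀ y₂ : ℕ) :
    ((1 - (dklmAtomA c ℓ k : ℂ)) ^ x₂ * star (transferJointPhase c ℓ k) ^ (y₂ + q₂) -
          star (transferJointPhase c ℓ k) ^ y₂) *
        (1 - (dklmAtomA c ℓ k : ℂ)) ^ x₁' *
        (transferJointPhase c ℓ k ^ (y₀ + q₁) - (1 - (dklmAtomA c ℓ k : ℂ)) ^ x₁ * transferJointPhase c ℓ k ^ y₀) =
      chiDiscr x₁ q₁ x₁' ((y₂ : ℤ) - y₀ - q₁) x₂ q₂ (dklmAtomA c ℓ k, dklmPhaseB c ℓ k) := by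
  have hq : transferJointPhase c ℓ k ^ q₁ * star (transferJointPhase c ℓ k) ^ q₁ = 1 := by
    rw [← mul_pow, mul_comm, RCLike.star_def, conj_transferJointPhase_mul_self, one_pow]
  unfold chiDiscr
  simp only [Int.cast_sub, Int.cast_natCast]
  rw [show -(Complex.I * ((dklmPhaseB c ℓ k : ℝ) : ℂ) * ((y₂ : ℂ) - y₀ - q₁)) =
      -(Complex.I * (dklmPhaseB c ℓ k : ℂ) * y₂) + Complex.I * (dklmPhaseB c ℓ k : ℂ) * y₀ +
        Complex.I * (dklmPhaseB c ℓ k : ℂ) * q₁ by ring,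
    Complex.exp_add, Complex.exp_add, exp_neg_I_mul_dklmPhaseB_mul, exp_neg_I_mul_dklmPhaseB_mul,
    exp_neg_I_mul_dklmPhaseB_mul, exp_I_mul_dklmPhaseB_mul, exp_I_mul_dklmPhaseB_mul, pow_add, pow_add]
  linear_combination (star (transferJointPhase c ℓ k) ^ y₂ *
    ((1 - (dklmAtomA c ℓ k : ℂ)) ^ x₂ * star (transferJointPhase c ℓ k) ^ q₂ - 1) *
    (1 - (dklmAtomA c ℓ k : ℂ)) ^ x₁' * transferJointPhase c ℓ k ^ y₀ * (1 - (dklmAtomA c ℓ k : ℂ)) ^ x₁) * hq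

include hc

/-- **Theorem 23 (spectral representation of the two-point function), eq. (eq:thm23), both
pairs L-shaped.** For `c > 0`, `L = 2(ℓ+1)`: pair 1 `u₁ = (face a₁, row y₀)`,
`u₁' = u₁ + (x₁, y₁)`, `x₁ = w₁'+1 ≥ 1`, `y₁ = q₁ ≥ 0`; pair 2 in the strip at horizontal offset
`r₁'+1+k`, `u₂ = (face a₂, row y₂)`, `u₂' = u₂ + (x₂, y₂)` with `x₂ = w₂'+1`, vertical leg `q₂`;
`u₂ - u₁' = (x₁', y₁')` with `x₁' = (r₁' - a₁ - w₁') + k + a₂ ≥ 0`, `y₁' = y₂ - y₀ - q₁`: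
`Φ_{CYL_L,2}(u) = ∫ ((1-a)^{x₂}e^{-ibq₂} - 1)(1-a)^{x₁'}e^{-iby₁'}(1 - (1-a)^{x₁}e^{-ibq₁}) dμ_L(a,b)`.
[cite: DKLM2026SixVertexGFF, Theorem 23] -/
theorem cylinderPairExp_lPairObs_lPairObs_eq_integral {r₁' r₂' : ℕ} (a₁ w₁' : ℕ)
    (h₁ : a₁ + w₁' + 1 ≤ r₁' + 1) (q₁ : ℕ) (a₂ w₂' : ℕ) (h₂ : a₂ + w₂' + 1 ≤ r₂' + 1) (q₂ : ℕ)
    (y₀ y₂ k : ℕ) :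
    ((cylinderPairExp c r₁' (lPairObs r₁' a₁ w₁' h₁ q₁ ((y₀ : ℕ) : ZMod (2 * (ℓ + 1)))) (r₁' + 1 + k) r₂'
        (lPairObs r₂' a₂ w₂' h₂ q₂ ((y₂ : ℕ) : ZMod (2 * (ℓ + 1)))) : ℝ) : ℂ) =
      ∫ p, chiDiscr (w₁' + 1) q₁ ((r₁' - a₁ - w₁') + k + a₂) ((y₂ : ℤ) - y₀ - q₁) (w₂' + 1) q₂ p
        ∂dklmMeasure c hc ℓ := by
  refine ofReal_eq_integral_dklmMeasure c hc ℓ (fun a b => conj_chiDiscr _ _ _ _ _ _ a b) ?_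
  rw [cylinderPairExp_lPairObs_lPairObs_eq_sum c hc ℓ a₁ w₁' h₁ q₁ a₂ w₂' h₂ q₂ y₀ y₂ k]
  refine Finset.sum_congr rfl fun j _ => ?_
  rw [← spectralTerm_eq_chiDiscr, mul_assoc, mul_assoc, mul_assoc]

end Theorem23

/-! ## 5. The corner cases `x₁ = 0` / `x₂ = 0` (purely vertical pairs) by bilinearity -/

section Corner

variable {G₂ : Type*} [AddCommGroup G₂] [One G₂] [Fintype G₂] [DecidableEq G₂]

omit [Fintype G₂] [DecidableEq G₂] in
/-- An L-observable without vertical leg is its row block. [folklore] -/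
theorem lPairObs_zero (r' a w' : ℕ) (h : a + w' + 1 ≤ r' + 1) (y : G₂) :
    lPairObs r' a w' h 0 y = rowBlockObs r' a w' h y := by
  funext i κ α
  simp [lPairObs, colObs]

omit [Fintype G₂] [DecidableEq G₂] in
/-- **A vertical difference is a difference of two L-observables** (path additivity):
`h(v + (0,q)) - h(v) = (h(v + (0,q)) - h(v - e₁)) - (h(v) - h(v - e₁))` for the face `v = s + 1`.
[cite: DKLM2026SixVertexGFF, Def. 2.3] -/
theorem colObs_eq_lPairObs_sub (r' : ℕ) (s : Fin (r' + 1)) (q : ℕ) (y : G₂) :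
    colObs r' s q y =
      lPairObs r' s 0 (by have := s.2; omega) q y - lPairObs r' s 0 (by have := s.2; omega) 0 y := by
  have hs : (⟨(s : ℕ) + 0, by have := s.2; omega⟩ : Fin (r' + 1)) = s := Fin.ext (Nat.add_zero _)
  rw [lPairObs_zero, lPairObs, hs, add_sub_cancel_left]

variable [Nonempty {κ : G₂ → Bool // IsBalancedCol κ}]

/-- Bilinearity: left differences. [cite: DKLM2026SixVertexGFF, proof of Theorem 23, Step 1] -/
theorem cylinderPairExp_sub_left (c : ℝ) (hc : 0 < c) {r₁' r₂' : ℕ}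
    (X X' : (G₂ → Bool) → (Fin (r₁' + 1) → G₂ → Bool) → (Fin (r₁' + 1) → G₂ → Bool) → ℝ)
    (Y : (G₂ → Bool) → (Fin (r₂' + 1) → G₂ → Bool) → (Fin (r₂' + 1) → G₂ → Bool) → ℝ) (k : ℕ) :
    cylinderPairExp c r₁' (X - X') (r₁' + 1 + k) r₂' Y =
      cylinderPairExp c r₁' X (r₁' + 1 + k) r₂' Y - cylinderPairExp c r₁' X' (r₁' + 1 + k) r₂' Y := by
  rw [sub_eq_add_neg, ← neg_one_smul ℝ X', cylinderPairExp_add_left c hc, cylinderPairExp_smul_left c hc]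
  ring

/-- Bilinearity: right differences. [cite: DKLM2026SixVertexGFF, proof of Theorem 23, Step 1] -/
theorem cylinderPairExp_sub_right (c : ℝ) (hc : 0 < c) {r₁' r₂' : ℕ}
    (X : (G₂ → Bool) → (Fin (r₁' + 1) → G₂ → Bool) → (Fin (r₁' + 1) → G₂ → Bool) → ℝ)
    (Y Y' : (G₂ → Bool) → (Fin (r₂' + 1) → G₂ → Bool) → (Fin (r₂' + 1) → G₂ → Bool) → ℝ) (k : ℕ) :
    cylinderPairExp c r₁' X (r₁' + 1 + k) r₂' (Y - Y') =
      cylinderPairExp c r₁' X (r₁' + 1 + k) r₂' Y - cylinderPairExp c r₁' X (r₁' + 1 + k) r₂' Y' := by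
  rw [sub_eq_add_neg, ← neg_one_smul ℝ Y', cylinderPairExp_add_right c hc, cylinderPairExp_smul_right c hc]
  ring

end Corner

section CornerL

variable (c : ℝ) (hc : 0 < c) (ℓ : ℕ)

include hc

/-- **Theorem 23, corner case `x₁ = 0`** (pair 1 purely vertical: `u₁ = (face s₁+1, row y₀)`,
`u₁' = u₁ + (0, q₁)`; pair 2 L-shaped; `x₁' = (r₁' - s₁) + k + a₂`), by bilinearity from the
L-shaped case. [cite: DKLM2026SixVertexGFF, Theorem 23] -/
theorem cylinderPairExp_colObs_lPairObs_eq_sum {r₁' r₂' : ℕ} (s₁ : Fin (r₁' + 1)) (q₁ : ℕ) (a₂ w₂' : ℕ)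
    (h₂ : a₂ + w₂' + 1 ≤ r₂' + 1) (q₂ : ℕ) (y₀ y₂ k : ℕ) :
    ((cylinderPairExp c r₁' (colObs r₁' s₁ q₁ ((y₀ : ℕ) : ZMod (2 * (ℓ + 1)))) (r₁' + 1 + k) r₂'
        (lPairObs r₂' a₂ w₂' h₂ q₂ ((y₂ : ℕ) : ZMod (2 * (ℓ + 1)))) : ℝ) : ℂ) =
      ∑ j, (dklmWeight c hc ℓ j : ℂ) *
        ((1 - (dklmAtomA c ℓ j : ℂ)) ^ (w₂' + 1) * star (transferJointPhase c ℓ j) ^ (y₂ + q₂) -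
          star (transferJointPhase c ℓ j) ^ y₂) *
        (1 - (dklmAtomA c ℓ j : ℂ)) ^ ((r₁' - s₁) + k + a₂) *
        (transferJointPhase c ℓ j ^ (y₀ + q₁) - transferJointPhase c ℓ j ^ y₀) := by
  rw [colObs_eq_lPairObs_sub, cylinderPairExp_sub_left c hc, Complex.ofReal_sub,
    cylinderPairExp_lPairObs_lPairObs_eq_sum c hc ℓ, cylinderPairExp_lPairObs_lPairObs_eq_sum c hc ℓ,
    ← Finset.sum_sub_distrib]
  refine Finset.sum_congr rfl fun j _ => ?_
  simp only [Nat.sub_zero, add_zero, zero_add, pow_one]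
  ring

/-- **Theorem 23, corner case `x₂ = 0`** (pair 1 L-shaped; pair 2 purely vertical:
`u₂ = (face s₂+1, row y₂)` of the second strip, `u₂' = u₂ + (0, q₂)`;
`x₁' = (r₁' - a₁ - w₁') + k + s₂ + 1`). [cite: DKLM2026SixVertexGFF, Theorem 23] -/
theorem cylinderPairExp_lPairObs_colObs_eq_sum {r₁' r₂' : ℕ} (a₁ w₁' : ℕ) (h₁ : a₁ + w₁' + 1 ≤ r₁' + 1)
    (q₁ : ℕ) (s₂ : Fin (r₂' + 1)) (q₂ : ℕ) (y₀ y₂ k : ℕ) :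
    ((cylinderPairExp c r₁' (lPairObs r₁' a₁ w₁' h₁ q₁ ((y₀ : ℕ) : ZMod (2 * (ℓ + 1)))) (r₁' + 1 + k) r₂'
        (colObs r₂' s₂ q₂ ((y₂ : ℕ) : ZMod (2 * (ℓ + 1)))) : ℝ) : ℂ) =
      ∑ j, (dklmWeight c hc ℓ j : ℂ) *
        (star (transferJointPhase c ℓ j) ^ (y₂ + q₂) - star (transferJointPhase c ℓ j) ^ y₂) *
        (1 - (dklmAtomA c ℓ j : ℂ)) ^ ((r₁' - a₁ - w₁') + k + s₂ + 1) *
        (transferJointPhase c ℓ j ^ (y₀ + q₁) - (1 - (dklmAtomA c ℓ j : ℂ)) ^ (w₁' + 1) * transferJointPhase c ℓ j ^ y₀) := by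
  rw [colObs_eq_lPairObs_sub, cylinderPairExp_sub_right c hc, Complex.ofReal_sub,
    cylinderPairExp_lPairObs_lPairObs_eq_sum c hc ℓ, cylinderPairExp_lPairObs_lPairObs_eq_sum c hc ℓ,
    ← Finset.sum_sub_distrib]
  refine Finset.sum_congr rfl fun j _ => ?_
  simp only [add_zero, zero_add, pow_one]
  ring

/-- **Theorem 23, corner case `x₁ = x₂ = 0`** (both pairs purely vertical, at faces `s₁+1` of strip
1 and `s₂+1` of strip 2; `x₁' = (r₁' - s₁) + k + s₂ + 1`). [cite: DKLM2026SixVertexGFF, Theorem 23] -/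
theorem cylinderPairExp_colObs_colObs_eq_sum {r₁' r₂' : ℕ} (s₁ : Fin (r₁' + 1)) (q₁ : ℕ) (s₂ : Fin (r₂' + 1))
    (q₂ : ℕ) (y₀ y₂ k : ℕ) :
    ((cylinderPairExp c r₁' (colObs r₁' s₁ q₁ ((y₀ : ℕ) : ZMod (2 * (ℓ + 1)))) (r₁' + 1 + k) r₂'
        (colObs r₂' s₂ q₂ ((y₂ : ℕ) : ZMod (2 * (ℓ + 1)))) : ℝ) : ℂ) =
      ∑ j, (dklmWeight c hc ℓ j : ℂ) *
        (star (transferJointPhase c ℓ j) ^ (y₂ + q₂) - star (transferJointPhase c ℓ j) ^ y₂) *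
        (1 - (dklmAtomA c ℓ j : ℂ)) ^ ((r₁' - s₁) + k + s₂ + 1) *
        (transferJointPhase c ℓ j ^ (y₀ + q₁) - transferJointPhase c ℓ j ^ y₀) := by
  rw [colObs_eq_lPairObs_sub r₂', cylinderPairExp_sub_right c hc, Complex.ofReal_sub,
    cylinderPairExp_colObs_lPairObs_eq_sum c hc ℓ, cylinderPairExp_colObs_lPairObs_eq_sum c hc ℓ,
    ← Finset.sum_sub_distrib]
  refine Finset.sum_congr rfl fun j _ => ?_
  simp only [add_zero, zero_add, pow_one]
  ring

/-- **Theorem 23, eq. (eq:thm23), corner case `x₁ = 0`:** `Φ_{CYL_L,2}(u) = ∫ χ^discr_u dμ_L` with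
`x₁ = 0`, `y₁ = q₁`, `x₁' = (r₁' - s₁) + k + a₂`, `y₁' = y₂ - y₀ - q₁`, `x₂ = w₂'+1`, `y₂ ↦ q₂`.
[cite: DKLM2026SixVertexGFF, Theorem 23] -/
theorem cylinderPairExp_colObs_lPairObs_eq_integral {r₁' r₂' : ℕ} (s₁ : Fin (r₁' + 1)) (q₁ : ℕ)
    (a₂ w₂' : ℕ) (h₂ : a₂ + w₂' + 1 ≤ r₂' + 1) (q₂ : ℕ) (y₀ y₂ k : ℕ) :
    ((cylinderPairExp c r₁' (colObs r₁' s₁ q₁ ((y₀ : ℕ) : ZMod (2 * (ℓ + 1)))) (r₁' + 1 + k) r₂'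
        (lPairObs r₂' a₂ w₂' h₂ q₂ ((y₂ : ℕ) : ZMod (2 * (ℓ + 1)))) : ℝ) : ℂ) =
      ∫ p, chiDiscr 0 q₁ ((r₁' - s₁) + k + a₂) ((y₂ : ℤ) - y₀ - q₁) (w₂' + 1) q₂ p ∂dklmMeasure c hc ℓ := by
  refine ofReal_eq_integral_dklmMeasure c hc ℓ (fun a b => conj_chiDiscr _ _ _ _ _ _ a b) ?_
  rw [cylinderPairExp_colObs_lPairObs_eq_sum c hc ℓ]
  refine Finset.sum_congr rfl fun j _ => ?_
  rw [← spectralTerm_eq_chiDiscr]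
  ring

/-- **Theorem 23, eq. (eq:thm23), corner case `x₂ = 0`:** `x₁ = w₁'+1`, `y₁ = q₁`,
`x₁' = (r₁' - a₁ - w₁') + k + s₂ + 1`, `y₁' = y₂ - y₀ - q₁`, `x₂ = 0`, `y₂ ↦ q₂`.
[cite: DKLM2026SixVertexGFF, Theorem 23] -/
theorem cylinderPairExp_lPairObs_colObs_eq_integral {r₁' r₂' : ℕ} (a₁ w₁' : ℕ) (h₁ : a₁ + w₁' + 1 ≤ r₁' + 1)
    (q₁ : ℕ) (s₂ : Fin (r₂' + 1)) (q₂ : ℕ) (y₀ y₂ k : ℕ) :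
    ((cylinderPairExp c r₁' (lPairObs r₁' a₁ w₁' h₁ q₁ ((y₀ : ℕ) : ZMod (2 * (ℓ + 1)))) (r₁' + 1 + k) r₂'
        (colObs r₂' s₂ q₂ ((y₂ : ℕ) : ZMod (2 * (ℓ + 1)))) : ℝ) : ℂ) =
      ∫ p, chiDiscr (w₁' + 1) q₁ ((r₁' - a₁ - w₁') + k + s₂ + 1) ((y₂ : ℤ) - y₀ - q₁) 0 q₂ p
        ∂dklmMeasure c hc ℓ := by
  refine ofReal_eq_integral_dklmMeasure c hc ℓ (fun a b => conj_chiDiscr _ _ _ _ _ _ a b) ?_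
  rw [cylinderPairExp_lPairObs_colObs_eq_sum c hc ℓ]
  refine Finset.sum_congr rfl fun j _ => ?_
  rw [← spectralTerm_eq_chiDiscr]
  ring

/-- **Theorem 23, eq. (eq:thm23), corner case `x₁ = x₂ = 0`:** `y₁ = q₁`,
`x₁' = (r₁' - s₁) + k + s₂ + 1`, `y₁' = y₂ - y₀ - q₁`, `y₂ ↦ q₂`.
[cite: DKLM2026SixVertexGFF, Theorem 23] -/
theorem cylinderPairExp_colObs_colObs_eq_integral {r₁' r₂' : ℕ} (s₁ : Fin (r₁' + 1)) (q₁ : ℕ)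
    (s₂ : Fin (r₂' + 1)) (q₂ : ℕ) (y₀ y₂ k : ℕ) :
    ((cylinderPairExp c r₁' (colObs r₁' s₁ q₁ ((y₀ : ℕ) : ZMod (2 * (ℓ + 1)))) (r₁' + 1 + k) r₂'
        (colObs r₂' s₂ q₂ ((y₂ : ℕ) : ZMod (2 * (ℓ + 1)))) : ℝ) : ℂ) =
      ∫ p, chiDiscr 0 q₁ ((r₁' - s₁) + k + s₂ + 1) ((y₂ : ℤ) - y₀ - q₁) 0 q₂ p ∂dklmMeasure c hc ℓ := by
  refine ofReal_eq_integral_dklmMeasure c hc ℓ (fun a b => conj_chiDiscr _ _ _ _ _ _ a b) ?_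
  rw [cylinderPairExp_colObs_colObs_eq_sum c hc ℓ]
  refine Finset.sum_congr rfl fun j _ => ?_
  rw [← spectralTerm_eq_chiDiscr]
  ring

end CornerL

/-! ## 6. Theorem 23 as printed: existence of the spectral measure -/

section Statement

variable (c : ℝ) (hc : 0 < c) (ℓ : ℕ)

include hc

/-- **Theorem 23 (Spectral representation of the two-point function)** as printed: for `c > 0`
and `L = 2(ℓ+1)` there is a finite positive measure `μ_L` on `ℝ × ℝ`, carried by
`(0,2] × [-π,π]`, invariant under `(a,b) ↦ (a,-b)`, with `μ_L({|b| ∈ (0,2π/L)}) = 0`, such that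
`Φ_{CYL_L,2}(u) = ∫ χ^discr_u dμ_L` for the horizontally ordered two-pair configurations `u`
(both pairs L-shaped east-then-north inside their strips, `x_i = w_i'+1 ≥ 1`, or purely vertical,
`x_i = 0`; `x₁' ≥ 0`; vertical displacements `q_i ≥ 0` along the cylinder).
[cite: DKLM2026SixVertexGFF, Theorem 23] -/
theorem exists_dklm_spectralMeasure :
    ∃ μ : Measure (ℝ × ℝ), IsFiniteMeasure μ ∧
      μ (Set.Ioc (0 : ℝ) 2 ×ˢ Set.Icc (-Real.pi) Real.pi)ᶜ = 0 ∧
      μ.map (fun p : ℝ × ℝ => (p.1, -p.2)) = μ ∧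
      μ {p : ℝ × ℝ | |p.2| ∈ Set.Ioo 0 (2 * Real.pi / (2 * (ℓ + 1)))} = 0 ∧
      (∀ (r₁' r₂' a₁ w₁' : ℕ) (h₁ : a₁ + w₁' + 1 ≤ r₁' + 1) (q₁ a₂ w₂' : ℕ) (h₂ : a₂ + w₂' + 1 ≤ r₂' + 1)
          (q₂ y₀ y₂ k : ℕ),
        ((cylinderPairExp c r₁' (lPairObs r₁' a₁ w₁' h₁ q₁ ((y₀ : ℕ) : ZMod (2 * (ℓ + 1)))) (r₁' + 1 + k) r₂'
            (lPairObs r₂' a₂ w₂' h₂ q₂ ((y₂ : ℕ) : ZMod (2 * (ℓ + 1)))) : ℝ) : ℂ) =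
          ∫ p, chiDiscr (w₁' + 1) q₁ ((r₁' - a₁ - w₁') + k + a₂) ((y₂ : ℤ) - y₀ - q₁) (w₂' + 1) q₂ p ∂μ) ∧
      (∀ (r₁' r₂' : ℕ) (s₁ : Fin (r₁' + 1)) (q₁ a₂ w₂' : ℕ) (h₂ : a₂ + w₂' + 1 ≤ r₂' + 1) (q₂ y₀ y₂ k : ℕ),
        ((cylinderPairExp c r₁' (colObs r₁' s₁ q₁ ((y₀ : ℕ) : ZMod (2 * (ℓ + 1)))) (r₁' + 1 + k) r₂'
            (lPairObs r₂' a₂ w₂' h₂ q₂ ((y₂ : ℕ) : ZMod (2 * (ℓ + 1)))) : ℝ) : ℂ) =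
          ∫ p, chiDiscr 0 q₁ ((r₁' - s₁) + k + a₂) ((y₂ : ℤ) - y₀ - q₁) (w₂' + 1) q₂ p ∂μ) ∧
      (∀ (r₁' r₂' a₁ w₁' : ℕ) (h₁ : a₁ + w₁' + 1 ≤ r₁' + 1) (q₁ : ℕ) (s₂ : Fin (r₂' + 1)) (q₂ y₀ y₂ k : ℕ),
        ((cylinderPairExp c r₁' (lPairObs r₁' a₁ w₁' h₁ q₁ ((y₀ : ℕ) : ZMod (2 * (ℓ + 1)))) (r₁' + 1 + k) r₂'
            (colObs r₂' s₂ q₂ ((y₂ : ℕ) : ZMod (2 * (ℓ + 1)))) : ℝ) : ℂ) =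
          ∫ p, chiDiscr (w₁' + 1) q₁ ((r₁' - a₁ - w₁') + k + s₂ + 1) ((y₂ : ℤ) - y₀ - q₁) 0 q₂ p ∂μ) ∧
      (∀ (r₁' r₂' : ℕ) (s₁ : Fin (r₁' + 1)) (q₁ : ℕ) (s₂ : Fin (r₂' + 1)) (q₂ y₀ y₂ k : ℕ),
        ((cylinderPairExp c r₁' (colObs r₁' s₁ q₁ ((y₀ : ℕ) : ZMod (2 * (ℓ + 1)))) (r₁' + 1 + k) r₂'
            (colObs r₂' s₂ q₂ ((y₂ : ℕ) : ZMod (2 * (ℓ + 1)))) : ℝ) : ℂ) =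
          ∫ p, chiDiscr 0 q₁ ((r₁' - s₁) + k + s₂ + 1) ((y₂ : ℤ) - y₀ - q₁) 0 q₂ p ∂μ) := by
  refine ⟨dklmMeasure c hc ℓ, isFiniteMeasure_dklmMeasure c hc ℓ, ?_, dklmMeasure_map_reflect c hc ℓ,
    dklmMeasure_smallPhase c hc ℓ,
    fun r₁' r₂' a₁ w₁' h₁ q₁ a₂ w₂' h₂ q₂ y₀ y₂ k =>
      cylinderPairExp_lPairObs_lPairObs_eq_integral c hc ℓ a₁ w₁' h₁ q₁ a₂ w₂' h₂ q₂ y₀ y₂ k,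
    fun r₁' r₂' s₁ q₁ a₂ w₂' h₂ q₂ y₀ y₂ k =>
      cylinderPairExp_colObs_lPairObs_eq_integral c hc ℓ s₁ q₁ a₂ w₂' h₂ q₂ y₀ y₂ k,
    fun r₁' r₂' a₁ w₁' h₁ q₁ s₂ q₂ y₀ y₂ k =>
      cylinderPairExp_lPairObs_colObs_eq_integral c hc ℓ a₁ w₁' h₁ q₁ s₂ q₂ y₀ y₂ k,
    fun r₁' r₂' s₁ q₁ s₂ q₂ y₀ y₂ k => cylinderPairExp_colObs_colObs_eq_integral c hc ℓ s₁ q₁ s₂ q₂ y₀ y₂ k⟩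
  -- `(0,2) × [-π,π] ⊆ (0,2] × [-π,π]`
  refine measure_mono_null (Set.compl_subset_compl.2 (Set.prod_mono Set.Ioo_subset_Ioc_self subset_rfl)) ?_
  exact dklmMeasure_compl_support c hc ℓ

end Statement

end Literature.Probability.LatticeModels.SixVertex

end
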